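import Literature.Topology.FourManifolds.DehnSurgeryFramingProofs
import Literature.Topology.FourManifolds.SmallSetComplement
import Literature.AlgebraicTopology.FundamentalGroup.SphereCoreComplementPi1
import Literature.AlgebraicTopology.FundamentalGroup.CellAttachmentKernel
import Literature.AlgebraicTopology.Homotopy.HomotopyGroupsGeneralPosition
import Literature.AlgebraicTopology.FundamentalGroupoid.SimplyConnectedComplDiscrete
import HarnessLib

/-!
# The link group is normally generated by the meridians (Seifert–van Kampen)

Topic `Literature/Topology/FourManifolds`; sibling of `DehnSurgeryFramingProofs.lean` (which
proves the ONE-component statement `Knot.TubularNbhd.normalClosure_meridian_eq_top`: the knot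
group is the normal closure of the meridian, Crowell–Fox, Ch. VIII (1.1)). Written by the fact
seat of the barrier `Literature.Barriers.SmoothPoincare4.StrictPropertyTwoRBarrier`
(Gompf–Scharlemann–Thompson (2010), §7) as brick B2 of the `π₁`-theory its printed proof rests
on: *"If we pick a meridian of each component of `L` (attaching it to the base point by a path
in the complement), we obtain `n` elements `{rᵢ}` that normally generate `G`"* — here the
statement for the LINK GROUP `π₁(S³ ∖ L)`; together with the surjectivity
`π₁(S³ ∖ L) → π₁(S³_L)` of `DehnSurgeryLinkFundamentalGroup.lean` (brick B1) it gives GST's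
sentence for `G = π₁` of the surgered manifold. **Everything here is proved**; the definitions
introduced are auxiliary data with bodies (sub-link complements, the meridian as a loop of a
subset, the based meridian class, two homeomorphisms); no `Prop`-definition, no named fact.

## Main results

* `Link.normalClosure_conjMeridianClass_eq_top` — **for a smooth link `L ⊆ S³` with finitely
  many components, tubular neighbourhoods `ν i` missing the other components, a base point
  `x₀ ∈ S³ ∖ L` and paths `αᵢ` in `S³ ∖ L` from `x₀` to the base points of the tubes, the normal
  closure in `π₁(S³ ∖ L, x₀)` of the based meridian classes `[αᵢ · μᵢ · αᵢ⁻¹]` is the whole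
  group** (Crowell–Fox (1963), Ch. VIII (1.1) / Ch. VI for tame links through Wirtinger
  presentations: the meridians of one component are mutually conjugate and all of them
  generate; here for smooth links by van Kampen).
* `Link.normalClosure_conjMeridianClass_subCompl_eq_top` — the same for the complement
  `W_s = S³ ∖ ⋃_{i ∈ s} Kᵢ` of every sub-link (the inductive form).
* On the way: `Knot.TubularNbhd.fromPath_mem_zpowers_meridianInSet` (loops of the punctured
  partial tube are powers of the meridian, relative to any subset of `S³ ∖ K` containing it),
  `fromPath_mem_of_homotopic_refl_of_path` / `mem_of_inclHomOfSubset_eq_one` (van Kampen in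
  kernel form with the base point anywhere in `U` / for nested subsets),
  `surjective_inclHomOfSubset_of_isSimplyConnected` (Hatcher Lemma 1.15 with a simply connected
  piece), `bijective_inclHomOfSubset_diff_singleton` (removing a point from an open subset of
  `S³` does not change `π₁`), `Link.isPathConnected_subCompl`.

## Proof (induction on the number of components)

`W_∅ = S³` is simply connected (`simplyConnectedSpace_euclideanSphere`). For `i ∉ s`:
`W_s ∖ {Kᵢ(-1,0)} = W_{s ∪ {i}} ∪ Tᵢ` with `Tᵢ = ν i((S¹ ∖ {(-1,0)}) × ℝ²)` the partial tube
(simply connected: an interval times a plane,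
`Knot.TubularNbhd.isSimplyConnected_image_setOf_fst_ne_ptB`) and overlap the punctured partial
tube `Pᵢ = ν i((S¹ ∖ {(-1,0)}) × (ℝ² ∖ 0))`, whose loops at the base point of `ν i` are powers
of the meridian *inside `Pᵢ`* (`Knot.TubularNbhd.fromPath_mem_zpowers_meridianInSet`, the
relative form of `fromPath_mem_zpowers_meridian` of `DehnSurgeryFramingProofs.lean`). Hence:
(1) by Seifert–van Kampen in kernel form (`VanKampen.fromPath_mem_of_homotopic_refl`, Hatcher
Thm. 1.20) the kernel of `π₁(W_{s ∪ {i}}, x₀) → π₁(W_s ∖ pt, x₀)` lies in the normal closure of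
`[αᵢ μᵢ αᵢ⁻¹]`; (2) this map is onto (Hatcher Lemma 1.15, `Tᵢ` simply connected) and
`π₁(W_s ∖ pt) → π₁(W_s)` is bijective (removing a point from a 3-manifold, from the tree's
`VanKampen.bijective_inclHom_compl_core`); (3) by induction the images of the classes
`[αₖ μₖ αₖ⁻¹]`, `k ∈ s`, normally generate `π₁(W_s, x₀)`; a diagram chase concludes.

## References

* R. H. Crowell, R. H. Fox, *Introduction to Knot Theory* (1963), Ch. VI, Ch. VIII (1.1).
  [CrowellFox1963]
* A. Hatcher, *Algebraic Topology* (2002), Prop. 1.5, Lemma 1.15, Thm. 1.20, Prop. 1.26.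
  [HatcherAT2002]
* A. Kosinski, *Differential Manifolds* (1993), Ch. VI §2, Ch. X §2 (proof of Thm. 2.2).
  [Kosinski1993]
* W. Hurewicz, H. Wallman, *Dimension Theory* (1941), Ch. IV §5, Thm. IV 4. [HurewiczWallman1941]
* R. E. Gompf, M. Scharlemann, A. Thompson, *Fibered knots and potential counterexamples to the
  Property 2R and Slice-Ribbon Conjectures*, Geom. Topol. 14 (2010), §7 (arXiv:1103.1601, p. 16).
  [GompfScharlemannThompson2010]

## Design notes

* Everything is phrased with subsets of `S³` and the tree's `VanKampen.inclHom` /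
  `inclHomOfSubset` calculus; the step's subspace bookkeeping is done once in the two general
  lemmas `fromPath_mem_of_homotopic_refl_of_path` and `mem_of_inclHomOfSubset_eq_one`.
* The tubes are only required to miss the OTHER components
  (`hν : i ≠ k → Disjoint (range (ν i)) (range (L.component k))`), as provided by
  `Link.exists_tubularNbhd_pairwise_disjoint` / `IsIntegralSurgeryLink`.
* `Knot.TubularNbhd.meridianInSet` is so named to avoid the unrelated
  `Knot.TubularNbhd.meridianIn` of `LinkingNumberSymmProofs.lean` (meridian in another knot's
  complement).
* No `sorry`; the main theorem depends only on `propext`, `Classical.choice`, `Quot.sound`.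
-/

open Complex hiding I
open Set Function unitInterval
open scoped Topology Manifold ContDiff Real
open _root_.Topology (IsOpenEmbedding IsEmbedding)

noncomputable section

namespace Literature.Topology.FourManifolds

/-- Local notation: `𝔼 n` is the model Euclidean space `EuclideanSpace ℝ (Fin n)`. -/
local notation "𝔼 " n:arg => EuclideanSpace ℝ (Fin n)

/-- Local notation: `𝕊 n` is the unit sphere in `EuclideanSpace ℝ (Fin (n + 1))`. -/
local notation "𝕊 " n:arg => (Metric.sphere (0 : EuclideanSpace ℝ (Fin (n + 1))) 1)

open PlaneComplex Literature.AlgebraicTopology.FundamentalGroup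
open Literature.AlgebraicTopology.FundamentalGroup.VanKampen

namespace Knot.TubularNbhd

/-! ### Loops in the punctured partial tube are powers of the meridian (relative form) -/

section SliceRel

variable {K : Knot} (ν : Knot.TubularNbhd K)

/-- The **punctured partial tube** `ν((S¹ ∖ {(-1,0)}) × (ℝ² ∖ 0))` of an oriented tubular
neighbourhood: the part of the tube off the knot and off one meridian disc. [folklore] -/
abbrev puncturedPartialTube : Set (𝕊 3) := ν '' ({p | p.1 ≠ ptB} ∩ {p | p.2 ≠ 0})

/-- The meridian lies in the punctured partial tube. [folklore] -/
theorem meridian_mem_puncturedPartialTube (t : I) :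
    (ν.meridian t : 𝕊 3) ∈ ν.puncturedPartialTube := by
  rw [ν.meridian_eq_tubeMap t, tubeMap_apply_coe]
  exact ⟨_, ⟨circlePt_ne_ptB (PuncturedPlane.sliceWindingLoop baseAngle (1 / 2)
    one_half_pos t).1.2, ofC_ne_zero (PuncturedPlane.sliceWindingLoop baseAngle (1 / 2)
    one_half_pos t).2.2⟩, rfl⟩

/-- The base point lies in the punctured partial tube. [folklore] -/
theorem coe_basePoint_mem_puncturedPartialTube :
    (ν.basePoint : 𝕊 3) ∈ ν.puncturedPartialTube := by
  have h := ν.meridian_mem_puncturedPartialTube 0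
  rwa [ν.meridian.source] at h

/-- The meridian of `ν` as a loop of `S³`. [folklore] -/
def meridianLoop : Path (ν.basePoint : 𝕊 3) (ν.basePoint : 𝕊 3) :=
  ν.meridian.map continuous_subtype_val

/-- Points of the meridian loop. [folklore] -/
@[simp] theorem meridianLoop_apply (t : I) : ν.meridianLoop t = (ν.meridian t : 𝕊 3) := rfl

/-- The meridian loop lies in the punctured partial tube. [folklore] -/
theorem meridianLoop_mem_puncturedPartialTube (t : I) :
    ν.meridianLoop t ∈ ν.puncturedPartialTube :=
  ν.meridian_mem_puncturedPartialTube t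

variable {U : Set (𝕊 3)} (hPU : ν.puncturedPartialTube ⊆ U)

/-- The meridian as a loop of a set `U ⊇` punctured partial tube (the lift of `meridianLoop`).
[folklore] -/
def meridianInSet : Path (⟨(ν.basePoint : 𝕊 3), hPU ν.coe_basePoint_mem_puncturedPartialTube⟩ : U)
    ⟨(ν.basePoint : 𝕊 3), hPU ν.coe_basePoint_mem_puncturedPartialTube⟩ :=
  liftPath U ν.meridianLoop fun t => hPU (ν.meridianLoop_mem_puncturedPartialTube t)

/-- Points of `meridianInSet`. [folklore] -/
@[simp] theorem coe_meridianInSet_apply (t : I) :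
    (ν.meridianInSet hPU t : 𝕊 3) = ν.meridian t := rfl

/-- The punctured partial tube map into `U`. [folklore] -/
def tubeMapIn : C(angleIoo × PuncturedPlane.CStar, U) where
  toFun a := ⟨ν (circlePt a.1, ofC (a.2 : ℂ)),
    hPU ⟨_, ⟨circlePt_ne_ptB a.1.2, ofC_ne_zero a.2.2⟩, rfl⟩⟩
  continuous_toFun :=
    (ν.continuous.comp ((continuous_circlePt.comp (continuous_subtype_val.comp
      continuous_fst)).prodMk (continuous_ofC.comp (continuous_subtype_val.comp
      continuous_snd)))).subtype_mk _

/-- Values of `tubeMapIn`. [folklore] -/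
theorem coe_tubeMapIn_apply (a : angleIoo × PuncturedPlane.CStar) :
    (ν.tubeMapIn hPU a : 𝕊 3) = ν (circlePt a.1, ofC (a.2 : ℂ)) := rfl

/-- **Loops in the punctured partial tube are powers of the meridian — relative form.** For an
open set `U ⊆ S³ ∖ K` containing the punctured partial tube `P = ν((S¹ ∖ {(-1,0)}) × (ℝ² ∖ 0))`
of a tubular neighbourhood `ν` of `K`, every loop of `U` at the base point `p₀` lying in `P` has
its class in `π₁(U, p₀)` in the cyclic subgroup generated by the meridian: as in
`fromPath_mem_zpowers_meridian` (the case `U = S³ ∖ K`, `DehnSurgeryFramingProofs.lean`) the loop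
is pulled back along the embedding `ν` and the angle `angB` to a loop of `(1/2, 3/2) × (ℂ ∖ 0)`,
whose class is a power of the slice winding loop (`PuncturedPlane.fromPath_mem_zpowers_slice`),
and everything is pushed forward into `U` by the tube map — the homotopies never leave `P ⊆ U`.
[folklore] -/
theorem fromPath_mem_zpowers_meridianInSet (hUK : U ⊆ (range K)ᶜ)
    (δ : Path (⟨(ν.basePoint : 𝕊 3), hPU ν.coe_basePoint_mem_puncturedPartialTube⟩ : U)
      ⟨(ν.basePoint : 𝕊 3), hPU ν.coe_basePoint_mem_puncturedPartialTube⟩)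
    (hδ : ∀ t, ((δ t : U) : 𝕊 3) ∈ ν '' {p | p.1 ≠ ptB}) :
    FundamentalGroup.fromPath (Path.Homotopic.Quotient.mk δ) ∈
      Subgroup.zpowers
        (FundamentalGroup.fromPath (Path.Homotopic.Quotient.mk (ν.meridianInSet hPU))) := by
  haveI : SimplyConnectedSpace angleIoo := simplyConnectedSpace_angleIoo
  have hr : (0 : ℝ) < 1 / 2 := one_half_pos
  -- pull the loop back to `S¹ × ℝ²` through the embedding `ν`
  let eν := ν.isSmoothEmbedding_coe.isEmbedding.toHomeomorph
  have hδr : ∀ t, ((δ t : U) : 𝕊 3) ∈ range ν := fun t => image_subset_range _ _ (hδ t)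
  let q : I → (𝕊 1) × 𝔼 2 := fun t => eν.symm ⟨((δ t : U) : 𝕊 3), hδr t⟩
  have hq : Continuous q := by
    refine eν.symm.continuous.comp (Continuous.subtype_mk ?_ _)
    exact continuous_subtype_val.comp δ.continuous
  have hνq : ∀ t, ν (q t) = ((δ t : U) : 𝕊 3) := fun t => by
    have h := congrArg Subtype.val (eν.apply_symm_apply ⟨((δ t : U) : 𝕊 3), hδr t⟩)
    rwa [Topology.IsEmbedding.toHomeomorph_apply_coe] at h
  have hq1 : ∀ t, (q t).1 ≠ ptB := fun t h1 => by
    obtain ⟨p, hp, hpt⟩ := hδ t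
    have : p = q t := ν.injective (hpt.trans (hνq t).symm)
    exact hp (this ▸ h1)
  have hq2 : ∀ t, (q t).2 ≠ 0 := fun t h0 => hUK (δ t).2 ⟨(q t).1, by
    have h' : ((q t).1, (0 : 𝔼 2)) = q t := Prod.ext rfl h0.symm
    rw [← ν.coe_apply_zero, h', hνq t]⟩
  have hbase : ∀ t, ((δ t : U) : 𝕊 3) = ν (circlePoint 0, framingBaseVector) →
      q t = (circlePoint 0, framingBaseVector) := fun t ht => by
    change eν.symm ⟨((δ t : U) : 𝕊 3), hδr t⟩ = _
    have : (⟨((δ t : U) : 𝕊 3), hδr t⟩ : range ν) =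
        ⟨ν (circlePoint 0, framingBaseVector), ⟨_, rfl⟩⟩ := Subtype.ext ht
    rw [this]
    exact Topology.IsEmbedding.toHomeomorph_symm_apply _ _
  have hq0 : q 0 = (circlePoint 0, framingBaseVector) :=
    hbase 0 (by rw [δ.source]; exact ν.coe_basePoint)
  have hq1' : q 1 = (circlePoint 0, framingBaseVector) :=
    hbase 1 (by rw [δ.target]; exact ν.coe_basePoint)
  -- the angle coordinate
  let θ : I → ℝ := fun t => angB (q t).1
  have hθ : Continuous θ :=
    continuous_iff_continuousAt.2 fun t =>
      ContinuousAt.comp (g := angB) (f := fun t => (q t).1) (x := t)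
        (continuousAt_angB (hq1 t)) hq.continuousAt.fst
  have hθmem : ∀ t, θ t ∈ angleIoo := fun t => angB_mem_Ioo (hq1 t)
  -- the loop in `(1/2, 3/2) × (ℂ ∖ 0)`
  let b : angleIoo × PuncturedPlane.CStar := (baseAngle, PuncturedPlane.bpt (1 / 2) hr)
  let δA : Path b b :=
    { toFun := fun t => (⟨θ t, hθmem t⟩, ⟨toC (q t).2, toC_ne_zero (hq2 t)⟩)
      continuous_toFun := (hθ.subtype_mk _).prodMk
        ((continuous_toC.comp (continuous_snd.comp hq)).subtype_mk _)
      source' := by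
        refine Prod.ext (Subtype.ext ?_) (Subtype.ext ?_)
        · change angB (q 0).1 = 1
          rw [hq0]
          exact angB_circlePoint_zero
        · change toC (q 0).2 = ((1 / 2 : ℝ) : ℂ)
          rw [hq0, framingBaseVector, toC_polar]
          simp
      target' := by
        refine Prod.ext (Subtype.ext ?_) (Subtype.ext ?_)
        · change angB (q 1).1 = 1
          rw [hq1']
          exact angB_circlePoint_zero
        · change toC (q 1).2 = ((1 / 2 : ℝ) : ℂ)
          rw [hq1', framingBaseVector, toC_polar]
          simp }
  have hδA : ∀ t, δ t = ν.tubeMapIn hPU (δA t) := fun t => by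
    apply Subtype.ext
    change ((δ t : U) : 𝕊 3) = ν (circlePt (angB (q t).1), ofC (toC (q t).2))
    rw [circlePt_angB, ofC_toC, Prod.mk.eta, hνq]
  have hb : ν.tubeMapIn hPU b =
      ⟨(ν.basePoint : 𝕊 3), hPU ν.coe_basePoint_mem_puncturedPartialTube⟩ := by
    apply Subtype.ext
    rw [coe_tubeMapIn_apply]
    exact congrArg Subtype.val ν.tubeMap_base
  have e1 := FundamentalGroup.mapOfEq_fromPath_eq (ν.tubeMapIn hPU) hb δA δ hδA
  have e2 := FundamentalGroup.mapOfEq_fromPath_eq (ν.tubeMapIn hPU) hb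
    (PuncturedPlane.sliceWindingLoop baseAngle (1 / 2) hr) (ν.meridianInSet hPU) (fun t => by
      apply Subtype.ext
      rw [coe_meridianInSet_apply, coe_tubeMapIn_apply, ν.meridian_eq_tubeMap t, tubeMap_apply_coe])
  obtain ⟨k, hk⟩ := Subgroup.mem_zpowers_iff.1
    (PuncturedPlane.fromPath_mem_zpowers_slice baseAngle (1 / 2) hr δA)
  rw [← e1, ← hk, map_zpow, e2]
  exact Subgroup.zpow_mem _ (Subgroup.mem_zpowers _) k

end SliceRel

end Knot.TubularNbhd

/-! ### Seifert–van Kampen in kernel form, base point anywhere in `U` -/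

section KernelFree

variable {Y : Type*} [TopologicalSpace Y]

/-- **Kernel form of van Kampen's theorem with the base point anywhere in `U`.** Let `Y = U ∪ T`
with `U`, `T` open, `U` and `U ∩ T` path connected, `x₀ ∈ U`, `x₁ ∈ U ∩ T`, `α` a path in
`U` from `x₀` to `x₁`, and `N ⊴ π₁(U, x₀)` a normal subgroup containing the class of
`α · δ · α⁻¹` for every loop `δ` of `U` at `x₁` lying in `T`. Then the class of every loop of
`U` at `x₀` that is null-homotopic in `Y` lies in `N` (the tree's
`VanKampen.fromPath_mem_of_homotopic_refl`, Hatcher Thm. 1.20, is the case `x₀ = x₁`; the general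
case follows by the change of base point along `α`, Hatcher Prop. 1.5).
[cite: HatcherAT2002, Thm. 1.20] -/
theorem fromPath_mem_of_homotopic_refl_of_path {U T : Set Y} (hU : IsOpen U) (hT : IsOpen T)
    (hUT : U ∪ T = univ) (hUpc : IsPathConnected U) (hmeet : IsPathConnected (U ∩ T))
    {x₀ x₁ : Y} (hx₀ : x₀ ∈ U) (hx₁U : x₁ ∈ U) (hx₁T : x₁ ∈ T) (α : Path x₀ x₁)
    (hα : ∀ t, α t ∈ U) (N : Subgroup (FundamentalGroup U ⟨x₀, hx₀⟩)) [N.Normal]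
    (hN : ∀ δ : Path (⟨x₁, hx₁U⟩ : U) ⟨x₁, hx₁U⟩, (∀ t, (δ t : Y) ∈ T) →
      FundamentalGroup.fromPath (Path.Homotopic.Quotient.mk
        (((liftPath U α hα).trans δ).trans (liftPath U α hα).symm)) ∈ N)
    (γ : Path (⟨x₀, hx₀⟩ : U) ⟨x₀, hx₀⟩)
    (hγ : (γ.map continuous_subtype_val).Homotopic (Path.refl x₀)) :
    FundamentalGroup.fromPath (Path.Homotopic.Quotient.mk γ) ∈ N := by
  set αU : Path (⟨x₀, hx₀⟩ : U) ⟨x₁, hx₁U⟩ := liftPath U α hα with hαU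
  -- change of base point along `α`
  let β : FundamentalGroup U ⟨x₀, hx₀⟩ ≃* FundamentalGroup U ⟨x₁, hx₁U⟩ :=
    FundamentalGroup.fundamentalGroupMulEquivOfPath αU
  let N₁ : Subgroup (FundamentalGroup U ⟨x₁, hx₁U⟩) := N.comap β.symm.toMonoidHom
  haveI : N₁.Normal := Subgroup.Normal.comap inferInstance _
  -- loops at `x₁` inside `T` lie in `N₁`
  have hN₁ : ∀ δ : Path (⟨x₁, hx₁U⟩ : U) ⟨x₁, hx₁U⟩, (∀ t, (δ t : Y) ∈ T) →
      FundamentalGroup.fromPath (Path.Homotopic.Quotient.mk δ) ∈ N₁ := by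
    intro δ hδ
    change β.symm.toMonoidHom _ ∈ N
    have hβ : β (FundamentalGroup.fromPath (Path.Homotopic.Quotient.mk
        ((αU.trans δ).trans αU.symm))) =
        FundamentalGroup.fromPath (Path.Homotopic.Quotient.mk δ) := by
      rw [fundamentalGroupMulEquivOfPath_fromPath_eq]
      apply congrArg FundamentalGroup.fromPath
      rw [Path.Homotopic.Quotient.mk_trans, Path.Homotopic.Quotient.mk_trans,
        Path.Homotopic.Quotient.mk_trans, Path.Homotopic.Quotient.mk_trans,
        Path.Homotopic.Quotient.mk_symm, Path.Homotopic.Quotient.trans_assoc,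
        Path.Homotopic.Quotient.trans_assoc, symm_trans_cancel,
        Path.Homotopic.Quotient.symm_trans, Path.Homotopic.Quotient.trans_refl]
    have : β.symm (FundamentalGroup.fromPath (Path.Homotopic.Quotient.mk δ)) =
        FundamentalGroup.fromPath (Path.Homotopic.Quotient.mk ((αU.trans δ).trans αU.symm)) := by
      rw [MulEquiv.symm_apply_eq, hβ]
    rw [MulEquiv.coe_toMonoidHom, this]
    exact hN δ hδ
  -- the conjugated loop `α⁻¹ · γ · α` at `x₁` is null-homotopic in `Y`
  let γ₁ : Path (⟨x₁, hx₁U⟩ : U) ⟨x₁, hx₁U⟩ := αU.symm.trans (γ.trans αU)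
  have hγ₁ : (γ₁.map continuous_subtype_val).Homotopic (Path.refl x₁) := by
    have hαval : αU.map continuous_subtype_val = α := by ext t; rfl
    have hαsval : αU.symm.map continuous_subtype_val = α.symm := by ext t; rfl
    have hmap : γ₁.map continuous_subtype_val =
        α.symm.trans ((γ.map continuous_subtype_val).trans α) := by
      change (αU.symm.trans (γ.trans αU)).map continuous_subtype_val = _
      rw [Path.map_trans, Path.map_trans, hαval, hαsval]
    rw [hmap]
    have h1 : (α.symm.trans ((γ.map continuous_subtype_val).trans α)).Homotopic
        (α.symm.trans ((Path.refl x₀).trans α)) :=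
      Path.Homotopic.hcomp (Path.Homotopic.refl _)
        (Path.Homotopic.hcomp hγ (Path.Homotopic.refl _))
    have h2 : (α.symm.trans ((Path.refl x₀).trans α)).Homotopic (α.symm.trans α) :=
      Path.Homotopic.hcomp (Path.Homotopic.refl _) ⟨Path.Homotopy.reflTrans α⟩
    have h3 : (α.symm.trans α).Homotopic (Path.refl x₁) :=
      ⟨(Path.Homotopy.reflSymmTrans α).symm⟩
    exact (h1.trans h2).trans h3
  have hmem := fromPath_mem_of_homotopic_refl hU hT hUT hUpc hmeet hx₁U hx₁T N₁ hN₁ γ₁ hγ₁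
  -- back to `x₀`
  have hβγ : β (FundamentalGroup.fromPath (Path.Homotopic.Quotient.mk γ)) =
      FundamentalGroup.fromPath (Path.Homotopic.Quotient.mk γ₁) := by
    rw [fundamentalGroupMulEquivOfPath_fromPath_eq]
  have : β.symm (FundamentalGroup.fromPath (Path.Homotopic.Quotient.mk γ₁)) =
      FundamentalGroup.fromPath (Path.Homotopic.Quotient.mk γ) := by
    rw [MulEquiv.symm_apply_eq, hβγ]
  have h := hmem
  change β.symm.toMonoidHom _ ∈ N at h
  rwa [MulEquiv.coe_toMonoidHom, this] at h

end KernelFree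

/-! ### The circle minus a point and the partial tube are simply connected -/

section PartialTube

/-- The circle minus the point `(-1, 0)` is homeomorphic to the angle interval `(1/2, 3/2)`
(`angB` / `circlePt`, `TorusCoordinates.lean`). [folklore] -/
def complPtBHomeomorph : ↥({ptB}ᶜ : Set (𝕊 1)) ≃ₜ Knot.TubularNbhd.angleIoo where
  toFun u := ⟨angB u, angB_mem_Ioo u.2⟩
  invFun θ := ⟨circlePt θ, Knot.TubularNbhd.circlePt_ne_ptB θ.2⟩
  left_inv u := Subtype.ext (circlePt_angB u)
  right_inv θ := Subtype.ext (angB_circlePt θ.2)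
  continuous_toFun := by
    refine Continuous.subtype_mk ?_ _
    exact continuous_iff_continuousAt.2 fun u =>
      (Knot.TubularNbhd.continuousAt_angB u.2).comp continuous_subtype_val.continuousAt
  continuous_invFun := (continuous_circlePt.comp continuous_subtype_val).subtype_mk _

/-- The circle minus a point is simply connected (it is an open interval). [folklore] -/
theorem simplyConnectedSpace_compl_ptB : SimplyConnectedSpace ↥({ptB}ᶜ : Set (𝕊 1)) := by
  haveI := Knot.TubularNbhd.simplyConnectedSpace_angleIoo
  exact complPtBHomeomorph.toHomotopyEquiv.simplyConnectedSpace_iff.2 inferInstance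

/-- The partial cylinder `(S¹ ∖ {(-1,0)}) × ℝ²` is simply connected. [folklore] -/
theorem isSimplyConnected_setOf_fst_ne_ptB :
    IsSimplyConnected {q : (𝕊 1) × (𝔼 2) | q.1 ≠ ptB} := by
  have heq : {q : (𝕊 1) × (𝔼 2) | q.1 ≠ ptB} = ({ptB}ᶜ : Set (𝕊 1)) ×ˢ (univ : Set (𝔼 2)) := by
    ext q; simp
  rw [heq]
  change SimplyConnectedSpace ↥(({ptB}ᶜ : Set (𝕊 1)) ×ˢ (univ : Set (𝔼 2)))
  haveI := simplyConnectedSpace_compl_ptB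
  haveI : SimplyConnectedSpace (↥({ptB}ᶜ : Set (𝕊 1)) × (𝔼 2)) := simplyConnectedSpace_prod
  let η : ↥(({ptB}ᶜ : Set (𝕊 1)) ×ˢ (univ : Set (𝔼 2))) ≃ₜ ↥({ptB}ᶜ : Set (𝕊 1)) × (𝔼 2) :=
    (Homeomorph.Set.prod _ _).trans
      (Homeomorph.prodCongr (Homeomorph.refl _) (Homeomorph.Set.univ _))
  exact η.toHomotopyEquiv.simplyConnectedSpace_iff.2 inferInstance

/-- **The partial tube `ν((S¹ ∖ {(-1,0)}) × ℝ²)` of a tubular neighbourhood is simply connected**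
(the embedded image of the simply connected partial cylinder). [folklore] -/
theorem Knot.TubularNbhd.isSimplyConnected_image_setOf_fst_ne_ptB {K : Knot}
    (ν : Knot.TubularNbhd K) : IsSimplyConnected (ν '' {q : (𝕊 1) × (𝔼 2) | q.1 ≠ ptB}) :=
  (ν.isSmoothEmbedding_coe.isEmbedding.isSimplyConnected_image (s := {q | q.1 ≠ ptB})).2
    isSimplyConnected_setOf_fst_ne_ptB

/-- The partial tube is path connected. [folklore] -/
theorem Knot.TubularNbhd.isPathConnected_image_setOf_fst_ne_ptB {K : Knot}
    (ν : Knot.TubularNbhd K) : IsPathConnected (ν '' {q : (𝕊 1) × (𝔼 2) | q.1 ≠ ptB}) :=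
  ν.isSimplyConnected_image_setOf_fst_ne_ptB.isPathConnected

/-- The punctured partial tube is path connected. [folklore] -/
theorem Knot.TubularNbhd.isPathConnected_puncturedPartialTube {K : Knot}
    (ν : Knot.TubularNbhd K) : IsPathConnected ν.puncturedPartialTube := by
  refine IsPathConnected.image ?_ ν.continuous
  have h1 : IsPathConnected ({ptB}ᶜ : Set (𝕊 1)) := by
    rw [Knot.TubularNbhd.compl_ptB_eq_image]
    exact ((convex_Ioo _ _).isPathConnected ⟨1, by norm_num, by norm_num⟩).image
      continuous_circlePt
  have h2 : IsPathConnected ({0}ᶜ : Set (𝔼 2)) := by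
    apply isPathConnected_compl_singleton_of_one_lt_rank
    rw [← Module.finrank_eq_rank, finrank_euclideanSpace_fin]
    norm_num
  convert h1.prod h2 using 1
  ext p
  simp

end PartialTube

/-! ### Removing a point from an open subset of `S³` does not change `π₁` -/

section PointRemoval

open Metric Literature.AlgebraicTopology.FundamentalGroupoid

/-- A Euclidean chart at a point of `S³` inside a prescribed open neighbourhood: an open
embedding `j : ℝ³ ↪ S³` with `j 0 = c` and `range j ⊆ O` (a ball in a chart at `c`). [folklore] -/
theorem exists_isOpenEmbedding_apply_zero_eq_range_subset_sphere (c : 𝕊 3) {O : Set (𝕊 3)}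
    (hO : IsOpen O) (hc : c ∈ O) :
    ∃ j : 𝔼 3 → 𝕊 3, IsOpenEmbedding j ∧ j 0 = c ∧ ∀ v, j v ∈ O := by
  obtain ⟨i, hi, hi0⟩ :=
    Literature.AlgebraicTopology.Homotopy.exists_isOpenEmbedding_apply_zero_eq (E := 𝔼 3) c
  obtain ⟨r, hr, hball⟩ : ∃ r > 0, ball (0 : 𝔼 3) r ⊆ i ⁻¹' O := by
    refine Metric.isOpen_iff.1 (hO.preimage hi.continuous) 0 ?_
    change i 0 ∈ O
    rwa [hi0]
  refine ⟨i ∘ OpenPartialHomeomorph.univBall (0 : 𝔼 3) r,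
    hi.comp ((OpenPartialHomeomorph.univBall (0 : 𝔼 3) r).to_isOpenEmbedding
      (OpenPartialHomeomorph.univBall_source 0 r)), ?_, fun v => ?_⟩
  · simp only [Function.comp_apply, OpenPartialHomeomorph.univBall_apply_zero, hi0]
  · refine hball ?_
    rw [← OpenPartialHomeomorph.univBall_target (0 : 𝔼 3) hr]
    exact OpenPartialHomeomorph.map_source _
      (by rw [OpenPartialHomeomorph.univBall_source]; exact mem_univ _)

/-- Rewriting the subset in `inclHom` along an equality of sets. [folklore] -/
theorem bijective_inclHom_congr {Y : Type*} [TopologicalSpace Y] {S S' : Set Y} (e : S = S')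
    {x : Y} (h : x ∈ S) (h' : x ∈ S') :
    Function.Bijective (inclHom S x h) ↔ Function.Bijective (inclHom S' x h') := by
  subst e
  exact Iff.rfl

/-- `ℝ³ ∖ 0` is simply connected. [cite: HatcherAT2002, Prop. 1.14] -/
theorem simplyConnectedSpace_compl_zero_euclideanThree :
    SimplyConnectedSpace ↥(({0} : Set (𝔼 3))ᶜ) := by
  have h := isSimplyConnected_compl_singleton_of_isOpenEmbedding
    (M := 𝔼 3) (i := id) IsOpenEmbedding.id
    (by rw [finrank_euclideanSpace, Fintype.card_fin]; norm_num)
  exact h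

/-- **Removing a point from an open path-connected subset `W ⊆ S³` does not change `π₁`**: for
`c ∈ W` and a base point `x₀ ∈ W ∖ {c}` (with `W ∖ {c}` path connected) the homomorphism
`π₁(W ∖ {c}, x₀) → π₁(W, x₀)` induced by the inclusion is bijective (van Kampen with a Euclidean
ball about `c`: the tree's `VanKampen.bijective_inclHom_compl_core` for the core of the tube
`pt × ℝ³`, whose punctured fibre `ℝ³ ∖ 0` is simply connected; Kosinski (1993), VI.2).
[cite: Kosinski1993, Ch. X §2, Thm. 2.2 (proof)] -/
theorem bijective_inclHomOfSubset_diff_singleton {W : Set (𝕊 3)} (hW : IsOpen W)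
    (hWpc : IsPathConnected W) {c : 𝕊 3} (hc : c ∈ W) (hpc : IsPathConnected (W \ {c}))
    {x₀ : 𝕊 3} (hx₀ : x₀ ∈ W \ {c}) :
    Function.Bijective (inclHomOfSubset (sdiff_subset : W \ {c} ⊆ W) x₀ hx₀ hx₀.1) := by
  -- a Euclidean neighbourhood of `c` inside `W`, corestricted to the subspace `W`
  obtain ⟨j, hj, hj0, hjW⟩ := exists_isOpenEmbedding_apply_zero_eq_range_subset_sphere c hW hc
  let j' : 𝔼 3 → ↥W := W.codRestrict j hjW
  have hj' : IsOpenEmbedding j' := isOpenEmbedding_codRestrict hj hjW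
  let φ : PUnit.{1} × (𝔼 3) → ↥W := j' ∘ Homeomorph.punitProd (𝔼 3)
  have hφ : IsOpenEmbedding φ := hj'.comp (Homeomorph.punitProd (𝔼 3)).isOpenEmbedding
  haveI : PathConnectedSpace ↥W := isPathConnected_iff_pathConnectedSpace.1 hWpc
  haveI := simplyConnectedSpace_compl_zero_euclideanThree
  -- a point of the tube off the core
  haveI : Nontrivial (𝔼 3) := Module.nontrivial_of_finrank_pos (R := ℝ)
    (by rw [finrank_euclideanSpace, Fintype.card_fin]; norm_num)
  obtain ⟨v₀, hv₀⟩ := exists_ne (0 : 𝔼 3)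
  have hb := bijective_inclHom_compl_core hφ (q₀ := (PUnit.unit, v₀)) hv₀
  -- the core is the point `c`
  have hcore : (φ '' (univ ×ˢ ({0} : Set (𝔼 3))))ᶜ = (Subtype.val ⁻¹' (W \ {c}) : Set ↥W) := by
    ext w
    simp only [mem_compl_iff, mem_image, mem_prod, mem_univ, true_and, mem_singleton_iff,
      Prod.exists, exists_eq_left, mem_preimage, mem_sdiff]
    constructor
    · intro h
      refine ⟨w.2, fun hw => h ⟨PUnit.unit, Subtype.ext ?_⟩⟩
      change j 0 = (w : 𝕊 3)
      rw [hj0, hw]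
    · rintro ⟨-, hw⟩ ⟨u, hu⟩
      apply hw
      have : (w : 𝕊 3) = j 0 := by rw [← hu]; rfl
      rw [this, hj0]
  have hφq : φ (PUnit.unit, v₀) = ⟨j v₀, hjW v₀⟩ := rfl
  have hx₁ : j v₀ ∈ W \ {c} := by
    refine ⟨hjW v₀, fun h => hv₀ (hj.injective ?_)⟩
    rw [hj0]; exact h
  have hmem : (⟨j v₀, hjW v₀⟩ : ↥W) ∈ (φ '' (univ ×ˢ ({0} : Set (𝔼 3))))ᶜ := by
    rw [hcore]; exact hx₁
  have hb' : Function.Bijective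
      (inclHom (Subtype.val ⁻¹' (W \ {c}) : Set ↥W) ⟨j v₀, hjW v₀⟩ hx₁) := by
    rw [← bijective_inclHom_congr hcore hmem hx₁]
    exact hb
  -- move the base point to `x₀` inside `W ∖ {c}` and change presentation
  have hpc' : IsPathConnected (Subtype.val ⁻¹' (W \ {c}) : Set ↥W) := hpc.preimage_coe sdiff_subset
  obtain ⟨δ, hδ⟩ := hpc'.joinedIn ⟨x₀, hx₀.1⟩ hx₀ ⟨j v₀, hjW v₀⟩ hx₁
  have hs : Function.Surjective (inclHom (Subtype.val ⁻¹' (W \ {c}) : Set ↥W) ⟨x₀, hx₀.1⟩ hx₀) :=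
    (surjective_inclHom_iff_of_path (S := (Subtype.val ⁻¹' (W \ {c}) : Set ↥W))
      (x₀ := ⟨x₀, hx₀.1⟩) (x₁ := ⟨j v₀, hjW v₀⟩) hx₀ hx₁ δ hδ).2 hb'.2
  have hi : Function.Injective (inclHom (Subtype.val ⁻¹' (W \ {c}) : Set ↥W) ⟨x₀, hx₀.1⟩ hx₀) :=
    (injective_inclHom_iff_of_path (S := (Subtype.val ⁻¹' (W \ {c}) : Set ↥W))
      (x₀ := ⟨x₀, hx₀.1⟩) (x₁ := ⟨j v₀, hjW v₀⟩) hx₀ hx₁ δ hδ).2 hb'.1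
  exact ⟨(injective_inclHomOfSubset_iff_preimageVal sdiff_subset hx₀).2 hi,
    (surjective_inclHomOfSubset_iff_preimageVal sdiff_subset hx₀).2 hs⟩

end PointRemoval

/-! ### Kernel form for nested subsets `U ⊆ W` of an ambient space -/

section KernelNested

variable {Z : Type*} [TopologicalSpace Z]

/-- The canonical homeomorphism `↥U ≃ₜ ↥(W ↓∩ U)` for `U ⊆ W`. [folklore] -/
def subsetHomeomorphPreimageVal {U W : Set Z} (hUW : U ⊆ W) :
    ↥U ≃ₜ ↥(Subtype.val ⁻¹' U : Set ↥W) where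
  toFun a := ⟨⟨a, hUW a.2⟩, a.2⟩
  invFun w := ⟨w.1, w.2⟩
  left_inv _ := rfl
  right_inv _ := rfl
  continuous_toFun := (continuous_subtype_val.subtype_mk _).subtype_mk _
  continuous_invFun := (continuous_subtype_val.comp continuous_subtype_val).subtype_mk _

/-- **Kernel form of van Kampen's theorem for nested subsets.** Let `W = U ∪ T ⊆ Z` with `U`, `T`
open, `U` and `U ∩ T` path connected, `x₀ ∈ U`, `x₁ ∈ U ∩ T`, `α` a path in `U` from `x₀` to
`x₁`, and `N ⊴ π₁(U, x₀)` a normal subgroup containing the class of `α · δ · α⁻¹` for every loop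
`δ` of `U` at `x₁` inside `T`. Then every element of the kernel of `π₁(U, x₀) → π₁(W, x₀)` lies
in `N` (`fromPath_mem_of_homotopic_refl_of_path` inside the subspace `↥W`).
[cite: HatcherAT2002, Thm. 1.20] -/
theorem mem_of_inclHomOfSubset_eq_one {U T W : Set Z} (hUW : U ⊆ W)
    (hU : IsOpen U) (hT : IsOpen T) (hUT : U ∪ T = W) (hUpc : IsPathConnected U)
    (hmeet : IsPathConnected (U ∩ T)) {x₀ x₁ : Z} (hx₀ : x₀ ∈ U) (hx₁U : x₁ ∈ U)
    (hx₁T : x₁ ∈ T) (α : Path x₀ x₁) (hα : ∀ t, α t ∈ U)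
    (N : Subgroup (FundamentalGroup U ⟨x₀, hx₀⟩)) [N.Normal]
    (hN : ∀ δ : Path (⟨x₁, hx₁U⟩ : U) ⟨x₁, hx₁U⟩, (∀ t, (δ t : Z) ∈ T) →
      FundamentalGroup.fromPath (Path.Homotopic.Quotient.mk
        (((liftPath U α hα).trans δ).trans (liftPath U α hα).symm)) ∈ N)
    (g : FundamentalGroup U ⟨x₀, hx₀⟩) (hg : inclHomOfSubset hUW x₀ hx₀ (hUW hx₀) g = 1) :
    g ∈ N := by
  -- the pieces inside the subspace `↥W`
  set U' : Set ↥W := Subtype.val ⁻¹' U with hU'def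
  set T' : Set ↥W := Subtype.val ⁻¹' T with hT'def
  have hU'o : IsOpen U' := hU.preimage continuous_subtype_val
  have hT'o : IsOpen T' := hT.preimage continuous_subtype_val
  have hU'T' : U' ∪ T' = univ := by
    ext w
    simp only [hU'def, hT'def, mem_union, mem_preimage, mem_univ, iff_true]
    have hw : (w : Z) ∈ U ∪ T := by rw [hUT]; exact w.2
    exact hw
  have hU'pc : IsPathConnected U' := hUpc.preimage_coe hUW
  have hmeet' : IsPathConnected (U' ∩ T') := hmeet.preimage_coe (inter_subset_left.trans hUW)
  have hx₀' : (⟨x₀, hUW hx₀⟩ : ↥W) ∈ U' := hx₀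
  have hx₁U' : (⟨x₁, hUW hx₁U⟩ : ↥W) ∈ U' := hx₁U
  have hx₁T' : (⟨x₁, hUW hx₁U⟩ : ↥W) ∈ T' := hx₁T
  -- the path `α` inside `↥W`
  let αW : Path (⟨x₀, hUW hx₀⟩ : ↥W) ⟨x₁, hUW hx₁U⟩ := liftPath W α fun t => hUW (hα t)
  have hαW : ∀ t, αW t ∈ U' := fun t => hα t
  -- the canonical homeomorphism `↥U ≃ₜ ↥U'` and the transported subgroup
  let η : ↥U ≃ₜ ↥U' := subsetHomeomorphPreimageVal hUW
  have hη₀ : η ⟨x₀, hx₀⟩ = ⟨⟨x₀, hUW hx₀⟩, hx₀'⟩ := rfl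
  have hη₁ : η ⟨x₁, hx₁U⟩ = ⟨⟨x₁, hUW hx₁U⟩, hx₁U'⟩ := rfl
  let θ : FundamentalGroup U ⟨x₀, hx₀⟩ ≃* FundamentalGroup U' ⟨⟨x₀, hUW hx₀⟩, hx₀'⟩ :=
    fundamentalGroupEquivOfHomeomorph η hη₀
  let N' : Subgroup (FundamentalGroup U' ⟨⟨x₀, hUW hx₀⟩, hx₀'⟩) := N.comap θ.symm.toMonoidHom
  haveI : N'.Normal := Subgroup.Normal.comap inferInstance _
  -- transport of loop classes along `η.symm`
  have hθsymm : ∀ (β' : Path (⟨⟨x₀, hUW hx₀⟩, hx₀'⟩ : U') ⟨⟨x₀, hUW hx₀⟩, hx₀'⟩)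
      (β : Path (⟨x₀, hx₀⟩ : U) ⟨x₀, hx₀⟩), (∀ t, β t = η.symm (β' t)) →
      θ.symm (FundamentalGroup.fromPath (Path.Homotopic.Quotient.mk β')) =
        FundamentalGroup.fromPath (Path.Homotopic.Quotient.mk β) := by
    intro β' β hβ
    rw [MulEquiv.symm_apply_eq]
    change FundamentalGroup.fromPath (Path.Homotopic.Quotient.mk β') =
      fundamentalGroupEquivOfHomeomorph η hη₀ _
    rw [fundamentalGroupEquivOfHomeomorph_apply]
    exact (FundamentalGroup.mapOfEq_fromPath_eq (η : C(↥U, ↥U')) hη₀ β β' fun t => by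
      rw [hβ t]; exact (η.apply_symm_apply _).symm).symm
  -- the hypothesis on loops inside `T'`
  have hN' : ∀ δ' : Path (⟨⟨x₁, hUW hx₁U⟩, hx₁U'⟩ : U') ⟨⟨x₁, hUW hx₁U⟩, hx₁U'⟩,
      (∀ t, ((δ' t : U') : ↥W) ∈ T') →
      FundamentalGroup.fromPath (Path.Homotopic.Quotient.mk
        (((liftPath U' αW hαW).trans δ').trans (liftPath U' αW hαW).symm)) ∈ N' := by
    intro δ' hδ'
    let δ : Path (⟨x₁, hx₁U⟩ : U) ⟨x₁, hx₁U⟩ := δ'.map η.symm.continuous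
    have hδ : ∀ t, (δ t : Z) ∈ T := fun t => hδ' t
    change θ.symm.toMonoidHom _ ∈ N
    rw [MulEquiv.coe_toMonoidHom, hθsymm _ (((liftPath U α hα).trans δ).trans
      (liftPath U α hα).symm) (fun t => ?_)]
    · exact hN δ hδ
    · -- pointwise comparison of the two conjugated loops
      simp only [Path.trans_apply, Path.symm_apply]
      split_ifs <;> rfl
  -- the transported element is null-homotopic in `↥W`
  obtain ⟨γ, rfl⟩ : ∃ γ : Path (⟨x₀, hx₀⟩ : U) ⟨x₀, hx₀⟩,
      FundamentalGroup.fromPath (Path.Homotopic.Quotient.mk γ) = g :=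
    Path.Homotopic.Quotient.mk_surjective (FundamentalGroup.toPath g)
  let γ' : Path (⟨⟨x₀, hUW hx₀⟩, hx₀'⟩ : U') ⟨⟨x₀, hUW hx₀⟩, hx₀'⟩ := γ.map η.continuous
  have hγ' : (γ'.map continuous_subtype_val).Homotopic (Path.refl (⟨x₀, hUW hx₀⟩ : ↥W)) := by
    have h1 : inclHomOfSubset hUW x₀ hx₀ (hUW hx₀)
        (FundamentalGroup.fromPath (Path.Homotopic.Quotient.mk γ)) =
        FundamentalGroup.fromPath (Path.Homotopic.Quotient.mk (γ'.map continuous_subtype_val)) := by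
      rw [inclHomOfSubset]
      exact FundamentalGroup.mapOfEq_fromPath_eq _ rfl γ _ fun t => rfl
    rw [h1, FundamentalGroup.one_def, ← Path.Homotopic.Quotient.mk_refl] at hg
    exact Path.Homotopic.Quotient.eq.1 hg
  have hmem := fromPath_mem_of_homotopic_refl_of_path hU'o hT'o hU'T' hU'pc hmeet' hx₀' hx₁U'
    hx₁T' αW hαW N' hN' γ' hγ'
  change θ.symm.toMonoidHom _ ∈ N at hmem
  rwa [MulEquiv.coe_toMonoidHom, hθsymm γ' γ (fun t => rfl)] at hmem

end KernelNested

/-! ### Conjugation of a loop class by a path -/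

section Conj

variable {X : Type*} [TopologicalSpace X]

/-- **Change of base point undoes conjugation by the path**: `β_A [A · δ · A⁻¹] = [δ]` for a path
`A` from `a` to `b` and a loop `δ` at `b` (Hatcher (2002), Prop. 1.5).
[cite: HatcherAT2002, Prop. 1.5] -/
theorem fundamentalGroupMulEquivOfPath_fromPath_conj {a b : X} (A : Path a b) (δ : Path b b) :
    FundamentalGroup.fundamentalGroupMulEquivOfPath A
        (FundamentalGroup.fromPath (Path.Homotopic.Quotient.mk ((A.trans δ).trans A.symm))) =
      FundamentalGroup.fromPath (Path.Homotopic.Quotient.mk δ) := by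
  rw [fundamentalGroupMulEquivOfPath_fromPath_eq]
  apply congrArg FundamentalGroup.fromPath
  rw [Path.Homotopic.Quotient.mk_trans, Path.Homotopic.Quotient.mk_trans,
    Path.Homotopic.Quotient.mk_trans, Path.Homotopic.Quotient.mk_trans,
    Path.Homotopic.Quotient.mk_symm, Path.Homotopic.Quotient.trans_assoc,
    Path.Homotopic.Quotient.trans_assoc, symm_trans_cancel,
    Path.Homotopic.Quotient.symm_trans, Path.Homotopic.Quotient.trans_refl]

/-- The conjugate class `[A · δ · A⁻¹]` is `β_A⁻¹ [δ]`. [cite: HatcherAT2002, Prop. 1.5] -/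
theorem fromPath_conj_eq_symm_apply {a b : X} (A : Path a b) (δ : Path b b) :
    FundamentalGroup.fromPath (Path.Homotopic.Quotient.mk ((A.trans δ).trans A.symm)) =
      (FundamentalGroup.fundamentalGroupMulEquivOfPath A).symm
        (FundamentalGroup.fromPath (Path.Homotopic.Quotient.mk δ)) := by
  rw [MulEquiv.eq_symm_apply, fundamentalGroupMulEquivOfPath_fromPath_conj]

end Conj

/-! ### Surjectivity of `π₁(U) → π₁(U ∪ T)` for a simply connected piece `T` -/

section SurjNested

variable {Z : Type*} [TopologicalSpace Z]

/-- **Generation (Hatcher, Lemma 1.15) for nested subsets with a simply connected piece.** If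
`W = U ∪ T ⊆ Z` with `U`, `T` open, `U`, `U ∩ T` path connected, `T` simply connected and
`x₀ ∈ U`, then `π₁(U, x₀) → π₁(W, x₀)` is surjective. [cite: HatcherAT2002, Lemma 1.15] -/
theorem surjective_inclHomOfSubset_of_isSimplyConnected {U T W : Set Z} (hUW : U ⊆ W)
    (hTW : T ⊆ W) (hU : IsOpen U) (hT : IsOpen T) (hUT : U ∪ T = W) (hUpc : IsPathConnected U)
    (hmeet : IsPathConnected (U ∩ T)) (hTsc : IsSimplyConnected T) {x₀ : Z} (hx₀ : x₀ ∈ U) :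
    Function.Surjective (inclHomOfSubset hUW x₀ hx₀ (hUW hx₀)) := by
  set U' : Set ↥W := Subtype.val ⁻¹' U with hU'def
  set T' : Set ↥W := Subtype.val ⁻¹' T with hT'def
  have hU'o : IsOpen U' := hU.preimage continuous_subtype_val
  have hT'o : IsOpen T' := hT.preimage continuous_subtype_val
  have hU'T' : U' ∪ T' = univ := by
    ext w
    simp only [hU'def, hT'def, mem_union, mem_preimage, mem_univ, iff_true]
    have hw : (w : Z) ∈ U ∪ T := by rw [hUT]; exact w.2
    exact hw
  have hU'pc : IsPathConnected U' := hUpc.preimage_coe hUW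
  have hT'pc : IsPathConnected T' := hTsc.isPathConnected.preimage_coe hTW
  have hmeet' : IsPathConnected (U' ∩ T') := hmeet.preimage_coe (inter_subset_left.trans hUW)
  -- `T'` is simply connected
  have hT'sc : IsSimplyConnected T' := by
    have himg : Subtype.val '' T' = T := by
      rw [hT'def, Subtype.image_preimage_coe, inter_eq_right]
      exact hTW
    have h := (IsEmbedding.subtypeVal.isSimplyConnected_image (s := T') (X := ↥W) (Y := Z))
    rw [himg] at h
    exact h.1 hTsc
  -- a base point in the overlap
  obtain ⟨x₁, hx₁U, hx₁T⟩ := hmeet.nonempty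
  have hx₁U' : (⟨x₁, hUW hx₁U⟩ : ↥W) ∈ U' := hx₁U
  have hx₁T' : (⟨x₁, hUW hx₁U⟩ : ↥W) ∈ T' := hx₁T
  haveI : Subsingleton (FundamentalGroup ↥T' ⟨⟨x₁, hUW hx₁U⟩, hx₁T'⟩) := by
    haveI : SimplyConnectedSpace ↥T' := hT'sc
    infer_instance
  have hgen := closure_range_inclHom_union_eq_top hU'o hT'o hU'T' hx₁U' hx₁T' hU'pc hT'pc hmeet'
  have hsurj₁ : Function.Surjective (inclHom U' _ hx₁U') := by
    rw [← MonoidHom.range_eq_top, ← top_le_iff, ← hgen, Subgroup.closure_le, MonoidHom.coe_range]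
    rintro b (hb | ⟨a, rfl⟩)
    · exact hb
    · rw [Subsingleton.elim a 1, map_one]
      exact ⟨1, map_one _⟩
  -- move the base point to `x₀`
  have hx₀' : (⟨x₀, hUW hx₀⟩ : ↥W) ∈ U' := hx₀
  obtain ⟨δ, hδ⟩ := hU'pc.joinedIn _ hx₀' _ hx₁U'
  have hsurj₀ : Function.Surjective (inclHom U' _ hx₀') :=
    (surjective_inclHom_iff_of_path hx₀' hx₁U' δ hδ).2 hsurj₁
  exact (surjective_inclHomOfSubset_iff_preimageVal hUW hx₀).2 hsurj₀

end SurjNested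

/-! ### The complement of a sub-link and the meridians -/

section LinkMeridians

variable {ι : Type*} (L : Link ι) (ν : ∀ i, Knot.TubularNbhd (L.component i))

/-- The **complement of the sub-link on `s`**: `S³` minus the components `Kᵢ`, `i ∈ s`.
[folklore] -/
def Link.subCompl (s : Finset ι) : Set (𝕊 3) := (⋃ i ∈ s, range ⇑(L.component i))ᶜ

variable {L} in
/-- Membership in the complement of a sub-link. [folklore] -/
theorem Link.mem_subCompl_iff {s : Finset ι} {x : 𝕊 3} :
    x ∈ L.subCompl s ↔ ∀ i ∈ s, x ∉ range ⇑(L.component i) := by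
  simp [Link.subCompl]

/-- The complement of a sub-link is open. [folklore] -/
theorem Link.isOpen_subCompl (s : Finset ι) : IsOpen (L.subCompl s) :=
  (s.finite_toSet.isClosed_biUnion fun i _ => (L.component i).isClosed_range).isOpen_compl

/-- Fewer components, larger complement. [folklore] -/
theorem Link.subCompl_mono {s t : Finset ι} (h : s ⊆ t) : L.subCompl t ⊆ L.subCompl s :=
  fun _ hx => Link.mem_subCompl_iff.2 fun i hi => Link.mem_subCompl_iff.1 hx i (h hi)

/-- The link complement lies in the complement of every sub-link. [folklore] -/
theorem Link.compl_carrier_subset_subCompl (s : Finset ι) : L.carrierᶜ ⊆ L.subCompl s :=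
  fun x hx => Link.mem_subCompl_iff.2 fun i _ hxi => hx ((L.mem_carrier_iff x).2 ⟨i, hxi⟩)

/-- The complement of all components is the link complement. [folklore] -/
theorem Link.subCompl_univ [Fintype ι] : L.subCompl Finset.univ = L.carrierᶜ := by
  ext x
  simp [Link.subCompl, Link.carrier]

/-- **The complement of a sub-link is path connected** (general position, as for the whole link:
`isPathConnected_compl_of_subset_iUnion_image`).
[cite: HurewiczWallman1941, Ch. IV §5, Thm. IV 4] -/
theorem Link.isPathConnected_subCompl (s : Finset ι) : IsPathConnected (L.subCompl s) := by
  haveI := Literature.AlgebraicTopology.FundamentalGroup.simplyConnectedSpace_euclideanSphere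
    3 (by norm_num)
  have hdim : Module.finrank ℝ ℝ + 2 ≤ Module.finrank ℝ (𝔼 3) := by
    simp only [Module.finrank_self, finrank_euclideanSpace_fin]; norm_num
  have hcl : IsClosed (⋃ i ∈ s, range ⇑(L.component i)) :=
    s.finite_toSet.isClosed_biUnion fun i _ => (L.component i).isClosed_range
  have hSint : ∀ x ∈ ⋃ i ∈ s, range ⇑(L.component i), (𝓡 3).IsInteriorPoint x := fun x _ ↦
    BoundarylessManifold.isInteriorPoint
  have hg : ∀ i : ↥s, ContMDiffOn 𝓘(ℝ, ℝ) (𝓡 3) 1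
      (fun θ ↦ L.component (i : ι) (circlePoint θ)) univ :=
    fun i ↦ (((L.component (i : ι)).contMDiff.comp contMDiff_circlePoint).of_le
      (by exact_mod_cast le_top)).contMDiffOn
  have hSsub : (⋃ i ∈ s, range ⇑(L.component i)) ⊆
      ⋃ i : ↥s, (fun θ ↦ L.component (i : ι) (circlePoint θ)) '' univ := by
    intro x hx
    simp only [mem_iUnion, exists_prop] at hx
    obtain ⟨i, hi, y, rfl⟩ := hx
    obtain ⟨θ, rfl⟩ := circlePoint_surjective y
    exact mem_iUnion.2 ⟨⟨i, hi⟩, θ, mem_univ θ, rfl⟩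
  exact isPathConnected_compl_of_subset_iUnion_image hdim hcl hSint
    (fun i : ↥s ↦ fun θ ↦ L.component (i : ι) (circlePoint θ)) (fun _ ↦ univ)
    (fun _ ↦ isOpen_univ) hg hSsub

variable (hν : ∀ ⦃i k : ι⦄, i ≠ k → Disjoint (range ⇑(ν i)) (range ⇑(L.component k)))
include hν

/-- A point of the tube `ν i` off its zero section lies in the link complement (the tube misses
the other components). [folklore] -/
theorem Link.apply_mem_compl_carrier (i : ι) {x : 𝕊 1} {w : 𝔼 2} (hw : w ≠ 0) :
    ν i (x, w) ∈ L.carrierᶜ := by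
  intro hx
  obtain ⟨k, hk⟩ := (L.mem_carrier_iff _).1 hx
  by_cases hik : i = k
  · subst hik
    exact (ν i).apply_mem_compl_range hw hk
  · exact Set.disjoint_left.1 (hν hik) (mem_range_self _) hk

/-- The punctured partial tube of `ν i` lies in the link complement. [folklore] -/
theorem Link.puncturedPartialTube_subset_compl_carrier (i : ι) :
    (ν i).puncturedPartialTube ⊆ L.carrierᶜ := by
  rintro _ ⟨⟨x, w⟩, ⟨-, hw⟩, rfl⟩
  exact L.apply_mem_compl_carrier ν hν i hw

/-- The punctured partial tube of `ν i` lies in the complement of every sub-link. [folklore] -/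
theorem Link.puncturedPartialTube_subset_subCompl (i : ι) (s : Finset ι) :
    (ν i).puncturedPartialTube ⊆ L.subCompl s :=
  (L.puncturedPartialTube_subset_compl_carrier ν hν i).trans (L.compl_carrier_subset_subCompl s)

/-- The partial tube of `ν i` lies in the complement of the sub-link on `s ∌ i`. [folklore] -/
theorem Link.image_setOf_fst_ne_ptB_subset_subCompl {i : ι} {s : Finset ι} (hi : i ∉ s) :
    ν i '' {q : (𝕊 1) × (𝔼 2) | q.1 ≠ ptB} ⊆ L.subCompl s := by
  rintro _ ⟨q, -, rfl⟩
  refine Link.mem_subCompl_iff.2 fun k hk hmem => ?_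
  have hik : i ≠ k := fun h => hi (h ▸ hk)
  exact Set.disjoint_left.1 (hν hik) (mem_range_self _) hmem

/-- **The cover of the step**: adding the partial tube of `Kᵢ` to the complement of the sub-link
on `insert i s` gives the complement of the sub-link on `s` minus one point of `Kᵢ`. [folklore] -/
theorem Link.subCompl_insert_union_image [DecidableEq ι] {i : ι} {s : Finset ι} (hi : i ∉ s) :
    L.subCompl (insert i s) ∪ ν i '' {q : (𝕊 1) × (𝔼 2) | q.1 ≠ ptB} =
      L.subCompl s \ {L.component i ptB} := by
  ext x
  constructor
  · rintro (hx | ⟨q, hq, rfl⟩)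
    · refine ⟨L.subCompl_mono (Finset.subset_insert i s) hx, fun h => ?_⟩
      rw [mem_singleton_iff] at h
      exact Link.mem_subCompl_iff.1 hx i (Finset.mem_insert_self i s) ⟨ptB, h.symm⟩
    · refine ⟨L.image_setOf_fst_ne_ptB_subset_subCompl ν hν hi ⟨q, hq, rfl⟩, fun h => ?_⟩
      rw [mem_singleton_iff, ← (ν i).coe_apply_zero] at h
      exact hq (congrArg Prod.fst ((ν i).injective h))
  · rintro ⟨hx, hxc⟩
    by_cases hxi : x ∈ range ⇑(L.component i)
    · obtain ⟨a, rfl⟩ := hxi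
      refine Or.inr ⟨(a, 0), fun (ha : a = ptB) => hxc (by rw [ha]; rfl), ?_⟩
      exact (ν i).coe_apply_zero a
    · refine Or.inl (Link.mem_subCompl_iff.2 fun k hk => ?_)
      rcases Finset.mem_insert.1 hk with rfl | hk
      · exact hxi
      · exact Link.mem_subCompl_iff.1 hx k hk

/-- **The overlap of the step** is the punctured partial tube. [folklore] -/
theorem Link.subCompl_insert_inter_image [DecidableEq ι] (i : ι) (s : Finset ι) :
    L.subCompl (insert i s) ∩ ν i '' {q : (𝕊 1) × (𝔼 2) | q.1 ≠ ptB} =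
      (ν i).puncturedPartialTube := by
  ext x
  constructor
  · rintro ⟨hx, q, hq, rfl⟩
    refine ⟨q, ⟨hq, fun h0 => ?_⟩, rfl⟩
    refine Link.mem_subCompl_iff.1 hx i (Finset.mem_insert_self i s) ⟨q.1, ?_⟩
    rw [← (ν i).coe_apply_zero q.1]
    exact congrArg (ν i) (Prod.ext rfl h0.symm)
  · rintro ⟨q, ⟨hq, hq0⟩, rfl⟩
    exact ⟨L.compl_carrier_subset_subCompl _ (L.apply_mem_compl_carrier ν hν i hq0),
      q, hq, rfl⟩

omit hν in
/-- The **based meridian class** `[α · μᵢ · α⁻¹] ∈ π₁(W, x₀)` of the component with tube `μ`, in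
a set `W` containing the punctured partial tube of `μ`, along a path `α` in `W` from `x₀` to
the base point of `μ` (Gompf–Scharlemann–Thompson (2010), §7: "attaching it to the base point
by a path"). [cite: GompfScharlemannThompson2010, §7] -/
def Knot.TubularNbhd.conjMeridianClass {K : Knot} (μ : Knot.TubularNbhd K) {W : Set (𝕊 3)}
    (hW : μ.puncturedPartialTube ⊆ W) {x₀ : 𝕊 3} (hx₀ : x₀ ∈ W)
    (α : Path x₀ (μ.basePoint : 𝕊 3)) (hα : ∀ t, α t ∈ W) : FundamentalGroup ↥W ⟨x₀, hx₀⟩ :=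
  FundamentalGroup.fromPath (Path.Homotopic.Quotient.mk
    (liftPath W ((α.trans μ.meridianLoop).trans α.symm)
      (trans_mem (trans_mem hα fun t => hW (μ.meridianLoop_mem_puncturedPartialTube t))
        (symm_mem hα))))

omit hν in
/-- The based meridian class is the conjugate `A · [μ] · A⁻¹` of the lifted meridian by the
lifted path. [folklore] -/
theorem Knot.TubularNbhd.conjMeridianClass_eq {K : Knot} (μ : Knot.TubularNbhd K)
    {W : Set (𝕊 3)} (hW : μ.puncturedPartialTube ⊆ W) {x₀ : 𝕊 3} (hx₀ : x₀ ∈ W)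
    (α : Path x₀ (μ.basePoint : 𝕊 3)) (hα : ∀ t, α t ∈ W) :
    μ.conjMeridianClass hW hx₀ α hα = FundamentalGroup.fromPath (Path.Homotopic.Quotient.mk
      (((liftPath W α hα).trans (μ.meridianInSet hW)).trans (liftPath W α hα).symm)) := by
  rw [Knot.TubularNbhd.conjMeridianClass]
  congr 2
  rw [liftPath_trans W (α.trans μ.meridianLoop) α.symm
      (trans_mem hα fun t => hW (μ.meridianLoop_mem_puncturedPartialTube t)) (symm_mem hα),
    liftPath_trans W α μ.meridianLoop hα fun t => hW (μ.meridianLoop_mem_puncturedPartialTube t),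
    liftPath_symm W α hα]
  rfl

omit hν in
/-- Naturality of the based meridian class under an inclusion `W ⊆ W'`. [folklore] -/
theorem Knot.TubularNbhd.inclHomOfSubset_conjMeridianClass {K : Knot} (μ : Knot.TubularNbhd K)
    {W W' : Set (𝕊 3)} (h : W ⊆ W') (hW : μ.puncturedPartialTube ⊆ W) {x₀ : 𝕊 3}
    (hx₀ : x₀ ∈ W) (α : Path x₀ (μ.basePoint : 𝕊 3)) (hα : ∀ t, α t ∈ W) :
    inclHomOfSubset h x₀ hx₀ (h hx₀) (μ.conjMeridianClass hW hx₀ α hα) =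
      μ.conjMeridianClass (hW.trans h) (h hx₀) α fun t => h (hα t) := by
  rw [Knot.TubularNbhd.conjMeridianClass, Knot.TubularNbhd.conjMeridianClass,
    inclHomOfSubset_fromPath_liftPath]

/-- **The link group is normally generated by the meridians — inductive form over sub-links.**
For every finite set `s` of components, every base point `x₀` in the complement `W_s` of the
sub-link on `s` and every choice of paths `αᵢ` in `W_s` from `x₀` to the base points of the tubes
`ν i` (`i ∈ s`), the normal closure in `π₁(W_s, x₀)` of the based meridian classes
`[αᵢ · μᵢ · αᵢ⁻¹]`, `i ∈ s`, is the whole group. Induction on `s`: `W_∅ = S³` is simply connected;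
for `i ∉ s`, `W_s ∖ {Kᵢ(-1,0)} = W_{s ∪ {i}} ∪ ν i((S¹ ∖ {(-1,0)}) × ℝ²)` with overlap the
punctured partial tube, whose loops are powers of `μᵢ`, so (van Kampen in kernel form) the
kernel of `π₁(W_{s ∪ {i}}) → π₁(W_s ∖ pt) ≅ π₁(W_s)` lies in the normal closure of `[αᵢ μᵢ αᵢ⁻¹]`,
while this map is onto and, by induction, the images of the other classes normally generate
the target (Crowell–Fox (1963), Ch. VIII (1.1) for one component; here for smooth links by
Seifert–van Kampen). [cite: CrowellFox1963, Ch. VIII (1.1)] [cite: HatcherAT2002, Thm. 1.20] -/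
theorem Link.normalClosure_conjMeridianClass_subCompl_eq_top [DecidableEq ι] (s : Finset ι) :
    ∀ {x₀ : 𝕊 3} (hx₀ : x₀ ∈ L.subCompl s) (α : ∀ i, Path x₀ ((ν i).basePoint : 𝕊 3))
      (hα : ∀ i ∈ s, ∀ t, α i t ∈ L.subCompl s),
      Subgroup.normalClosure (⋃ (i : ι) (hi : i ∈ s),
        {(ν i).conjMeridianClass (L.puncturedPartialTube_subset_subCompl ν hν i s) hx₀ (α i)
          (hα i hi)}) = ⊤ := by
  induction s using Finset.induction_on with
  | empty =>
    intro x₀ hx₀ α hα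
    -- `W_∅ = S³` is simply connected
    haveI : SimplyConnectedSpace ↥(L.subCompl ∅) := by
      have he : L.subCompl ∅ = univ := by simp [Link.subCompl]
      rw [he]
      haveI := Literature.AlgebraicTopology.FundamentalGroup.simplyConnectedSpace_euclideanSphere
        3 (by norm_num)
      exact (Homeomorph.Set.univ (𝕊 3)).toHomotopyEquiv.simplyConnectedSpace_iff.2 inferInstance
    rw [eq_top_iff]
    intro g _
    rw [Subsingleton.elim g 1]
    exact one_mem _
  | insert i s hi ih =>
    intro x₀ hx₀ α hα
    -- the sets of the step
    have hUT : L.subCompl (insert i s) ∪ ν i '' {q : (𝕊 1) × (𝔼 2) | q.1 ≠ ptB} =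
        L.subCompl s \ {L.component i ptB} := L.subCompl_insert_union_image ν hν hi
    have hUW : L.subCompl (insert i s) ⊆ L.subCompl s \ {L.component i ptB} :=
      hUT ▸ subset_union_left
    have hTW : ν i '' {q : (𝕊 1) × (𝔼 2) | q.1 ≠ ptB} ⊆ L.subCompl s \ {L.component i ptB} :=
      hUT ▸ subset_union_right
    have hWY : L.subCompl s \ {L.component i ptB} ⊆ L.subCompl s := sdiff_subset
    have hUY : L.subCompl (insert i s) ⊆ L.subCompl s := hUW.trans hWY
    have hmeetP := L.subCompl_insert_inter_image ν hν i s
    have hUo : IsOpen (L.subCompl (insert i s)) := L.isOpen_subCompl _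
    have hTo : IsOpen (ν i '' {q : (𝕊 1) × (𝔼 2) | q.1 ≠ ptB}) :=
      (ν i).isOpen_image (isOpen_compl_singleton.preimage continuous_fst)
    have hYo : IsOpen (L.subCompl s) := L.isOpen_subCompl _
    have hUpc : IsPathConnected (L.subCompl (insert i s)) := L.isPathConnected_subCompl _
    have hYpc : IsPathConnected (L.subCompl s) := L.isPathConnected_subCompl _
    have hmeet : IsPathConnected
        (L.subCompl (insert i s) ∩ ν i '' {q : (𝕊 1) × (𝔼 2) | q.1 ≠ ptB}) := by
      rw [hmeetP]; exact (ν i).isPathConnected_puncturedPartialTube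
    have hTsc : IsSimplyConnected (ν i '' {q : (𝕊 1) × (𝔼 2) | q.1 ≠ ptB}) :=
      (ν i).isSimplyConnected_image_setOf_fst_ne_ptB
    have hWpc : IsPathConnected (L.subCompl s \ {L.component i ptB}) := by
      rw [← hUT]
      refine hUpc.union hTsc.isPathConnected ⟨(ν i).basePoint, ?_⟩
      rw [hmeetP]
      exact (ν i).coe_basePoint_mem_puncturedPartialTube
    have hcY : L.component i ptB ∈ L.subCompl s := Link.mem_subCompl_iff.2 fun k hk hmem => by
      have hik : i ≠ k := fun h => hi (h ▸ hk)
      exact Set.disjoint_left.1 (L.disjoint hik) (mem_range_self ptB) hmem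
    have hx₀W : x₀ ∈ L.subCompl s \ {L.component i ptB} := hUW hx₀
    -- the base point of the tube of `Kᵢ` and the path to it
    have hPU : (ν i).puncturedPartialTube ⊆ L.subCompl (insert i s) :=
      L.puncturedPartialTube_subset_subCompl ν hν i _
    have hx₁U : ((ν i).basePoint : 𝕊 3) ∈ L.subCompl (insert i s) :=
      hPU (ν i).coe_basePoint_mem_puncturedPartialTube
    have hx₁T : ((ν i).basePoint : 𝕊 3) ∈ ν i '' {q : (𝕊 1) × (𝔼 2) | q.1 ≠ ptB} := by
      have h := (ν i).coe_basePoint_mem_puncturedPartialTube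
      rw [← hmeetP] at h
      exact h.2
    have hαi : ∀ t, α i t ∈ L.subCompl (insert i s) := hα i (Finset.mem_insert_self i s)
    -- the normal closure of the generators
    set N := Subgroup.normalClosure (⋃ (k : ι) (hk : k ∈ insert i s),
      {(ν k).conjMeridianClass (L.puncturedPartialTube_subset_subCompl ν hν k (insert i s)) hx₀
        (α k) (hα k hk)}) with hNdef
    haveI : N.Normal := Subgroup.normalClosure_normal
    -- Step 1 (kernel): the kernel of `π₁(U) → π₁(W)` lies in `N`
    have hker : ∀ g, inclHomOfSubset hUW x₀ hx₀ hx₀W g = 1 → g ∈ N := by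
      intro g hg
      refine mem_of_inclHomOfSubset_eq_one hUW hUo hTo hUT hUpc hmeet hx₀ hx₁U hx₁T (α i) hαi
        N (fun δ hδ => ?_) g hg
      -- loops at the base point inside `T` are powers of the meridian
      have hUK : L.subCompl (insert i s) ⊆ (range ⇑(L.component i))ᶜ := fun x hx =>
        Link.mem_subCompl_iff.1 hx i (Finset.mem_insert_self i s)
      have hzp := (ν i).fromPath_mem_zpowers_meridianInSet hPU hUK δ hδ
      obtain ⟨k, hk⟩ := Subgroup.mem_zpowers_iff.1 hzp
      have hconj : FundamentalGroup.fromPath (Path.Homotopic.Quotient.mk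
          (((liftPath _ (α i) hαi).trans δ).trans (liftPath _ (α i) hαi).symm)) =
          ((ν i).conjMeridianClass hPU hx₀ (α i) hαi) ^ k := by
        rw [(ν i).conjMeridianClass_eq hPU hx₀ (α i) hαi, fromPath_conj_eq_symm_apply,
          fromPath_conj_eq_symm_apply, ← map_zpow, hk]
      rw [hconj]
      exact Subgroup.zpow_mem _ (Subgroup.subset_normalClosure
        (mem_iUnion₂.2 ⟨i, Finset.mem_insert_self i s, rfl⟩)) k
    -- Step 2 (surjectivity): `π₁(U) → π₁(W)` is onto and `π₁(W) → π₁(W_s)` is bijective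
    have hsurjW : Function.Surjective (inclHomOfSubset hUW x₀ hx₀ hx₀W) :=
      surjective_inclHomOfSubset_of_isSimplyConnected hUW hTW hUo hTo hUT hUpc hmeet hTsc hx₀
    have hbij : Function.Bijective (inclHomOfSubset hWY x₀ hx₀W (hWY hx₀W)) :=
      bijective_inclHomOfSubset_diff_singleton hYo hYpc hcY hWpc hx₀W
    have hcomp : (inclHomOfSubset hWY x₀ hx₀W (hWY hx₀W)).comp
        (inclHomOfSubset hUW x₀ hx₀ hx₀W) = inclHomOfSubset hUY x₀ hx₀ (hUY hx₀) :=
      inclHomOfSubset_comp hUW hWY hx₀ hx₀W (hWY hx₀W)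
    have hcsurj : Function.Surjective (inclHomOfSubset hUY x₀ hx₀ (hUY hx₀)) := by
      rw [← hcomp, MonoidHom.coe_comp]
      exact hbij.2.comp hsurjW
    have hcker : ∀ g, inclHomOfSubset hUY x₀ hx₀ (hUY hx₀) g = 1 → g ∈ N := fun g hg =>
      hker g (hbij.1 (by rw [map_one, ← MonoidHom.comp_apply, hcomp]; exact hg))
    -- Step 3: the induction hypothesis in `W_s`, with the same base point and paths
    have hIH := ih (hUY hx₀) α fun k hk t => hUY (hα k (Finset.mem_insert_of_mem hk) t)
    have hNmap : N.map (inclHomOfSubset hUY x₀ hx₀ (hUY hx₀)) = ⊤ := by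
      rw [eq_top_iff, ← hIH]
      haveI : (N.map (inclHomOfSubset hUY x₀ hx₀ (hUY hx₀))).Normal :=
        Subgroup.Normal.map inferInstance _ hcsurj
      refine Subgroup.normalClosure_le_normal ?_
      intro y hy
      simp only [mem_iUnion, mem_singleton_iff] at hy
      obtain ⟨k, hk, rfl⟩ := hy
      refine ⟨(ν k).conjMeridianClass (L.puncturedPartialTube_subset_subCompl ν hν k (insert i s))
        hx₀ (α k) (hα k (Finset.mem_insert_of_mem hk)), ?_, ?_⟩
      · exact Subgroup.subset_normalClosure
          (mem_iUnion₂.2 ⟨k, Finset.mem_insert_of_mem hk, rfl⟩)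
      · exact (ν k).inclHomOfSubset_conjMeridianClass hUY _ hx₀ (α k) _
    -- conclusion
    rw [eq_top_iff]
    intro g _
    have hg : inclHomOfSubset hUY x₀ hx₀ (hUY hx₀) g ∈
        N.map (inclHomOfSubset hUY x₀ hx₀ (hUY hx₀)) := by
      rw [hNmap]; exact Subgroup.mem_top _
    obtain ⟨n, hn, hgn⟩ := hg
    have hq : inclHomOfSubset hUY x₀ hx₀ (hUY hx₀) (g * n⁻¹) = 1 := by
      rw [map_mul, map_inv, ← hgn, mul_inv_cancel]
    have hmem := hcker _ hq
    rw [← inv_mul_cancel_right g n]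
    exact N.mul_mem hmem hn

/-- **The link group is normally generated by the meridians** (Crowell–Fox (1963), Ch. VIII
(1.1) for one component; Rolfsen (1976), §3.D; Gompf–Scharlemann–Thompson (2010), §7: "If we
pick a meridian of each component of `L` … attaching it to the base point by a path, we obtain
`n` elements … that normally generate"). For a smooth link `L ⊆ S³` with finitely many
components, tubular neighbourhoods `ν i` missing the other components, a base point
`x₀ ∈ S³ ∖ L` and paths `αᵢ` in `S³ ∖ L` from `x₀` to the base points of the tubes, the normal
closure in `π₁(S³ ∖ L, x₀)` of the based meridian classes `[αᵢ · μᵢ · αᵢ⁻¹]` is the whole group.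
[cite: CrowellFox1963, Ch. VIII (1.1)] [cite: GompfScharlemannThompson2010, §7] -/
theorem Link.normalClosure_conjMeridianClass_eq_top [Finite ι] {x₀ : 𝕊 3}
    (hx₀ : x₀ ∈ L.carrierᶜ) (α : ∀ i, Path x₀ ((ν i).basePoint : 𝕊 3))
    (hα : ∀ i t, α i t ∈ L.carrierᶜ) :
    Subgroup.normalClosure (⋃ i, {(ν i).conjMeridianClass
      (L.puncturedPartialTube_subset_compl_carrier ν hν i) hx₀ (α i) (hα i)}) = ⊤ := by
  classical
  haveI := Fintype.ofFinite ι
  -- the statement for an arbitrary set equal to the link complement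
  suffices key : ∀ (W : Set (𝕊 3)) (hPW : ∀ i, (ν i).puncturedPartialTube ⊆ W) (hxW : x₀ ∈ W)
      (hαW : ∀ i t, α i t ∈ W), W = L.subCompl Finset.univ →
      Subgroup.normalClosure (⋃ i, {(ν i).conjMeridianClass (hPW i) hxW (α i) (hαW i)}) = ⊤ by
    exact key _ _ hx₀ hα (L.subCompl_univ).symm
  rintro W hPW hxW hαW rfl
  have h := L.normalClosure_conjMeridianClass_subCompl_eq_top ν hν Finset.univ hxW α
    fun i _ t => hαW i t
  simpa using h

end LinkMeridians

end Literature.Topology.FourManifolds
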